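import Literature.NumberTheory.Automorphic.VarmaLocalGlobalPrecI
import HarnessLib

/-!
# Varma 2024, Theorems 1–2 (`Varma2024.theorem12_trace_eq_and_precI`): the last mile

Topic `Literature/NumberTheory/Automorphic`, sibling of `VarmaLocalGlobalPrecI` (the named fact
`Literature.NumberTheory.Automorphic.Varma2024.theorem12_trace_eq_and_precI`, I. Varma,
*Local-global compatibility for regular algebraic cuspidal automorphic representations when
`ℓ ≠ p`*, Forum Math. Sigma 12 (2024) e21 = arXiv:1411.2520, Theorems 1 and 2).

## Discharge status of the fact (fact-owner's audit, 2026-08-15): OPEN, size XL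

The statement was read against the source (arXiv text, Introduction: Theorem 1^{ss} and
Theorem 1 = FMS Theorems 1 and 2; arXiv §9 = FMS §8: the orders `≺`, `≺_I` and Lemma 9.2 = FMS
Lemma 8.4 (2) = Bellaïche–Chenevier 6.5.3) and is faithful: conclusion (a) is the trace form of
"`WD(r|_{G_{F_v}})^{ss} = ı⁻¹rec(π_v ⊗ |det|^{(1-n)/2})^{ss}`" read on `ℂ`-points through `ι`,
conclusion (b) is "`WD(r|)^{Frob-ss} ≺ ı⁻¹rec(…)`" through Lemma 8.4 (2) and the insensitivity
of `≺_I` to Frobenius-semisimplification.  It is not provable in the tree: its first obligation,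
`∃ 𝓛 : ∀ v, LocalLanglandsDatum (K_v)`, is the local Langlands correspondence for every
`GL_m(K_v)` (the named fact `LocalLanglandsDatum.nonempty`, itself resting on the named facts
`localLanglands_gl` and `nonempty_localEpsilonSystem`), and its content is Harris–Lan–Taylor–
Thorne's construction of `r_{p,ı}(π)` through `p`-adic automorphic forms on `U(n,n)`, the action
of the Bernstein centre on them (Varma §§5–7, Prop. 7.1), Schneider–Zink types bounding the
monodromy (§8, Cor. 8.12) and patching (§9) — none of which exists as theorems.

## What is proved here (zero new facts)

The lemmas through which the printed, class-level theorems yield the fact's per-place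
conclusion, i.e. the "last mile" of any future discharge, all elementary linear algebra:

* `WeilDeligneRep.IsFrobSemisimplificationOf.trace_eq` — Frobenius-semisimplification does not
  change the traces `tr ρ(w)` (`ρ(w) = ρ(w)^{ss} + n`, `n` nilpotent has trace `0`).
* `WeilDeligneRep.Equiv.trace_eq`, `WeilDeligneRep.IsEquivalent.trace_eq` — isomorphic
  Weil–Deligne representations have the same traces; hence
  `Varma2024.trace_eq_of_mk_eq_mk` — two Frobenius-semisimple representatives of one class of
  `frobSemisimpleWDSetoid` (the target of `rec_n`) have the same traces, so conclusion (a) of the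
  fact does not depend on the representative `S` of `rec(π_v ⊗ |det|^{(1-n)/2})`.
* `WeilDeligneRep.IsTransportAlong.trace_eq` — `tr (ι r)(w) = ι (tr r(w))`.
* `repIsotypic_map_equiv`, `WeilDeligneRep.Equiv.map_inertiaIsotypic`,
  `WeilDeligneRep.Equiv.map_pow_N_inertiaIsotypic` — an isomorphism of Weil–Deligne
  representations carries the inertial isotypic components `V[θ]` and the subspaces `N^k V[θ]`
  onto each other; hence `WeilDeligneRep.Equiv.precI_iff_left/right`,
  `WeilDeligneRep.IsEquivalent.precI_iff_left/right` — Varma's `≺_I` (Definition 8.3) is an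
  invariant of the isomorphism classes on both sides (the accepted `WeilDeligneDominance` had
  only the same-space congruences `precI_congr_left/right`).
* `Varma2024.traceEq_and_precI_of_frobSemisimplification` — the reduction: if a
  Frobenius-semisimplification `W'` of `Wℂ` has the traces of, and is `≺_I`, some `S'` isomorphic
  to `S`, then `tr Wℂ.ρ = tr S.ρ` on `W_{K_v}` and `Wℂ ≺_I S` — exactly the passage from
  "`WD(r|)^{F-ss}` has the traces of / is `≺_I` the class `ı⁻¹rec(…)`" to the conclusion of
  `theorem12_trace_eq_and_precI` at a place.

## References

* I. Varma, Forum Math. Sigma 12 (2024) e21, doi:10.1017/fms.2024.7 (arXiv:1411.2520):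
  Thm. 1–2 (p. 2), Definition 8.2–8.3 (pp. 23–24), Lemma 8.4 (p. 24), Prop. 8.8 (p. 26).
  [VarmaFMS2024]
* J. Bellaïche, G. Chenevier, Astérisque 324 (2009), Lemma 6.5.3, §7.8. [BellaicheChenevier2009]
* P. Deligne, Antwerp II, LNM 349 (1973), §8.4–8.6. [DeligneAntwerpII1973]
-/

noncomputable section

open Module

namespace Literature.NumberTheory.Automorphic

open Literature.NumberTheory.GaloisRepresentations
open Literature.NumberTheory.GaloisRepresentations.WeilGroup

/-! ### Isotypic parts under an isomorphism of representations -/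

section RepIsotypic

variable {C : Type*} [Field C] {G : Type*} [Group G]
  {Vθ : Type*} [AddCommGroup Vθ] [Module C Vθ]
  {V : Type*} [AddCommGroup V] [Module C V] {W : Type*} [AddCommGroup W] [Module C W]

/-- An isomorphism of representations `φ : σ₁ ≅ σ₂` maps the `θ`-part of `σ₁` into the `θ`-part of
`σ₂` (`φ ∘ f` is equivariant for every equivariant `f : θ → σ₁`). [folklore] -/
theorem _root_.Literature.NumberTheory.GaloisRepresentations.repIsotypic_map_le_of_equiv
    (θ : Representation C G Vθ) {σ₁ : Representation C G V} {σ₂ : Representation C G W}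
    (φ : σ₁.Equiv σ₂) :
    (repIsotypic θ σ₁).map (φ.toLinearEquiv : V →ₗ[C] W) ≤ repIsotypic θ σ₂ := by
  unfold repIsotypic
  rw [Submodule.map_iSup]
  refine iSup_le fun f => ?_
  have h : Submodule.map (φ.toLinearEquiv : V →ₗ[C] W) (LinearMap.range f.toLinearMap) =
      LinearMap.range (φ.toIntertwiningMap.comp f).toLinearMap := by
    rw [Representation.IntertwiningMap.comp_toLinearMap, LinearMap.range_comp]
  rw [h]
  exact le_iSup (fun g : θ.IntertwiningMap σ₂ => LinearMap.range g.toLinearMap)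
    (φ.toIntertwiningMap.comp f)

/-- An isomorphism of representations `φ : σ₁ ≅ σ₂` maps the `θ`-part of `σ₁` onto the `θ`-part
of `σ₂`. [folklore] -/
theorem _root_.Literature.NumberTheory.GaloisRepresentations.repIsotypic_map_equiv
    (θ : Representation C G Vθ) {σ₁ : Representation C G V} {σ₂ : Representation C G W}
    (φ : σ₁.Equiv σ₂) :
    (repIsotypic θ σ₁).map (φ.toLinearEquiv : V →ₗ[C] W) = repIsotypic θ σ₂ := by
  refine le_antisymm (repIsotypic_map_le_of_equiv θ φ) ?_
  rw [Submodule.map_equiv_eq_comap_symm, ← Submodule.map_le_iff_le_comap]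
  exact repIsotypic_map_le_of_equiv θ φ.symm

end RepIsotypic

/-! ### Traces and `≺_I` are invariants of the isomorphism class -/

section WeilDeligne

variable {F : Type*} [Field F] [ValuativeRel F] [TopologicalSpace F] [IsNonarchimedeanLocalField F]
variable {C : Type*} [Field C] [CharZero C] {V : Type*} [AddCommGroup V] [Module C V]
  {V' : Type*} [AddCommGroup V'] [Module C V'] {V'' : Type*} [AddCommGroup V''] [Module C V'']
  {Vθ : Type*} [AddCommGroup Vθ] [Module C Vθ]

/-- **Frobenius-semisimplification does not change traces**: if `r'` is a
Frobenius-semisimplification of `r` then `tr r'.ρ(w) = tr r.ρ(w)` for every `w ∈ W_F`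
(`r.ρ w = r'.ρ w + n` with `n` nilpotent, and a nilpotent endomorphism has trace `0` over a
field).  This is why "`WD(…)^{ss}`", "`WD(…)^{Frob-ss}`" and `WD(…)` have the same traces in
Varma's Theorem 1. [cite: DeligneAntwerpII1973, §8.6] -/
theorem _root_.Literature.NumberTheory.GaloisRepresentations.WeilDeligneRep.IsFrobSemisimplificationOf.trace_eq
    {r' r : WeilDeligneRep F C V} (h : r'.IsFrobSemisimplificationOf r) (w : WeilGroup F) :
    LinearMap.trace C V (r'.ρ w) = LinearMap.trace C V (r.ρ w) := by
  obtain ⟨n, hn, -, hw⟩ := (h.2.2 w).2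
  rw [hw, map_add, (LinearMap.isNilpotent_trace_of_isNilpotent hn).eq_zero, add_zero]

/-- **Isomorphic Weil–Deligne representations have equal traces**: `tr r.ρ(w) = tr r'.ρ(w)` for an
isomorphism `e : r ≅ r'` (`r'.ρ w = e ∘ r.ρ w ∘ e⁻¹`, Mathlib `LinearMap.trace_conj'`).
[cite: DeligneAntwerpII1973, §8.4.1] -/
theorem _root_.Literature.NumberTheory.GaloisRepresentations.WeilDeligneRep.Equiv.trace_eq
    {r : WeilDeligneRep F C V} {r' : WeilDeligneRep F C V'} (e : r.Equiv r') (w : WeilGroup F) :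
    LinearMap.trace C V (r.ρ w) = LinearMap.trace C V' (r'.ρ w) := by
  rw [← Representation.Equiv.conj_apply_self w e.toRepEquiv, LinearMap.trace_conj']

/-- Isomorphic Weil–Deligne representations have equal traces (class form).
[cite: DeligneAntwerpII1973, §8.4.1] -/
theorem _root_.Literature.NumberTheory.GaloisRepresentations.WeilDeligneRep.IsEquivalent.trace_eq
    {r : WeilDeligneRep F C V} {r' : WeilDeligneRep F C V'} (h : r.IsEquivalent r')
    (w : WeilGroup F) :
    LinearMap.trace C V (r.ρ w) = LinearMap.trace C V' (r'.ρ w) :=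
  h.some.trace_eq w

/-- **Transport along `ι` maps traces**: if `r'` is `r` with scalars moved along `ι : E →+* C`
(`IsTransportAlong`: matrices mapped entrywise), then `tr r'.ρ(w) = ι (tr r.ρ(w))` — the sense
in which "`ı⁻¹`" enters Varma's Theorem 1. [cite: DeligneAntwerpII1973, §8.4.3] -/
theorem _root_.Literature.NumberTheory.GaloisRepresentations.WeilDeligneRep.IsTransportAlong.trace_eq
    {E : Type*} [Field E] [CharZero E] {n : ℕ} {ι : E →+* C}
    {r : WeilDeligneRep F E (Fin n → E)} {r' : WeilDeligneRep F C (Fin n → C)}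
    (h : r.IsTransportAlong ι r') (w : WeilGroup F) :
    LinearMap.trace C (Fin n → C) (r'.ρ w) = ι (LinearMap.trace E (Fin n → E) (r.ρ w)) := by
  rw [LinearMap.trace_eq_matrix_trace C (Pi.basisFun C (Fin n)),
    LinearMap.trace_eq_matrix_trace E (Pi.basisFun E (Fin n)), LinearMap.toMatrix_eq_toMatrix',
    LinearMap.toMatrix_eq_toMatrix', h.1 w, AddMonoidHom.map_trace]

/-- An isomorphism of Weil–Deligne representations restricts to an isomorphism of the
restrictions to inertia `ρ|_{I_F} ≅ ρ'|_{I_F}`. [folklore] -/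
theorem _root_.Literature.NumberTheory.GaloisRepresentations.WeilDeligneRep.Equiv.nonempty_restrictInertia_equiv
    {s₁ : WeilDeligneRep F C V} {s₂ : WeilDeligneRep F C V'} (e : s₁.Equiv s₂) :
    Nonempty (s₁.restrictInertia.Equiv s₂.restrictInertia) :=
  ⟨Representation.Equiv.mk e.toLinearEquiv fun u =>
    e.toIntertwiningMap.isIntertwining' (u : WeilGroup F)⟩

/-- An isomorphism `e : s₁ ≅ s₂` of Weil–Deligne representations maps the inertial isotypic
component `V[θ]` of `s₁` onto that of `s₂`. [cite: VarmaFMS2024, §8 (p. 24)] -/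
theorem _root_.Literature.NumberTheory.GaloisRepresentations.WeilDeligneRep.Equiv.map_inertiaIsotypic
    {s₁ : WeilDeligneRep F C V} {s₂ : WeilDeligneRep F C V'} (e : s₁.Equiv s₂)
    (θ : Representation C (inertia F) Vθ) :
    (s₁.inertiaIsotypic θ).map (e.toLinearEquiv : V →ₗ[C] V') = s₂.inertiaIsotypic θ := by
  let φ : s₁.restrictInertia.Equiv s₂.restrictInertia :=
    Representation.Equiv.mk e.toLinearEquiv fun u =>
      e.toIntertwiningMap.isIntertwining' (u : WeilGroup F)
  exact repIsotypic_map_equiv θ φ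

/-- An isomorphism of Weil–Deligne representations intertwines the powers of the monodromy
operators: `e ∘ N₁^k = N₂^k ∘ e`. [cite: DeligneAntwerpII1973, §8.4.1] -/
theorem _root_.Literature.NumberTheory.GaloisRepresentations.WeilDeligneRep.Equiv.comp_pow_N
    {s₁ : WeilDeligneRep F C V} {s₂ : WeilDeligneRep F C V'} (e : s₁.Equiv s₂) (k : ℕ) :
    (e.toLinearEquiv : V →ₗ[C] V') ∘ₗ (s₁.N ^ k) = (s₂.N ^ k) ∘ₗ (e.toLinearEquiv : V →ₗ[C] V') := by
  induction k with
  | zero => simp only [pow_zero, Module.End.one_eq_id, LinearMap.comp_id, LinearMap.id_comp]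
  | succ k ih =>
    have h1 : (e.toLinearEquiv : V →ₗ[C] V') ∘ₗ s₁.N = s₂.N ∘ₗ (e.toLinearEquiv : V →ₗ[C] V') :=
      e.comm_N
    rw [pow_succ s₁.N k, pow_succ s₂.N k, Module.End.mul_eq_comp, Module.End.mul_eq_comp,
      ← LinearMap.comp_assoc, ih, LinearMap.comp_assoc, h1, LinearMap.comp_assoc]

/-- An isomorphism `e : s₁ ≅ s₂` maps `N₁^k V[θ]` onto `N₂^k V'[θ]`.
[cite: VarmaFMS2024, Definition 8.3 and Prop. 8.8] -/
theorem _root_.Literature.NumberTheory.GaloisRepresentations.WeilDeligneRep.Equiv.map_pow_N_inertiaIsotypic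
    {s₁ : WeilDeligneRep F C V} {s₂ : WeilDeligneRep F C V'} (e : s₁.Equiv s₂)
    (θ : Representation C (inertia F) Vθ) (k : ℕ) :
    ((s₁.inertiaIsotypic θ).map (s₁.N ^ k)).map (e.toLinearEquiv : V →ₗ[C] V') =
      (s₂.inertiaIsotypic θ).map (s₂.N ^ k) := by
  rw [← Submodule.map_comp, e.comp_pow_N k, Submodule.map_comp, e.map_inertiaIsotypic θ]

/-- Hence the ranks `rk (N|_{V[θ]})^k = dim N^k V[θ]` entering `≺_I` are invariants of the
isomorphism class. [cite: VarmaFMS2024, Definition 8.3 and Prop. 8.8] -/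
theorem _root_.Literature.NumberTheory.GaloisRepresentations.WeilDeligneRep.Equiv.finrank_map_pow_N_inertiaIsotypic
    {s₁ : WeilDeligneRep F C V} {s₂ : WeilDeligneRep F C V'} (e : s₁.Equiv s₂)
    (θ : Representation C (inertia F) Vθ) (k : ℕ) :
    finrank C ↥((s₁.inertiaIsotypic θ).map (s₁.N ^ k)) =
      finrank C ↥((s₂.inertiaIsotypic θ).map (s₂.N ^ k)) := by
  rw [← e.map_pow_N_inertiaIsotypic θ k, LinearEquiv.finrank_map_eq]

/-- `≺_I` is invariant under isomorphism on the right: `r ≺_I s₁`, `s₁ ≅ s₂` ⟹ `r ≺_I s₂`.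
[cite: VarmaFMS2024, Definition 8.3] -/
theorem _root_.Literature.NumberTheory.GaloisRepresentations.WeilDeligneRep.Equiv.precI_of_precI_right
    {r : WeilDeligneRep F C V} {s₁ : WeilDeligneRep F C V'} {s₂ : WeilDeligneRep F C V''}
    (e : s₁.Equiv s₂) (h : r.PrecI s₁) : r.PrecI s₂ := by
  obtain ⟨⟨e₀⟩, h⟩ := h
  obtain ⟨e₁⟩ := e.nonempty_restrictInertia_equiv
  exact ⟨⟨e₀.trans e₁⟩, fun d θ hθ hθc k =>
    (h d θ hθ hθc k).trans_eq (e.finrank_map_pow_N_inertiaIsotypic θ k)⟩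

/-- `≺_I` is invariant under isomorphism on the right (iff form). [cite: VarmaFMS2024, Definition 8.3] -/
theorem _root_.Literature.NumberTheory.GaloisRepresentations.WeilDeligneRep.Equiv.precI_iff_right
    (r : WeilDeligneRep F C V) {s₁ : WeilDeligneRep F C V'} {s₂ : WeilDeligneRep F C V''}
    (e : s₁.Equiv s₂) : r.PrecI s₁ ↔ r.PrecI s₂ :=
  ⟨e.precI_of_precI_right, e.symm.precI_of_precI_right⟩

/-- `≺_I` is invariant under isomorphism on the left: `r₁ ≺_I s`, `r₁ ≅ r₂` ⟹ `r₂ ≺_I s`.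
[cite: VarmaFMS2024, Definition 8.3] -/
theorem _root_.Literature.NumberTheory.GaloisRepresentations.WeilDeligneRep.Equiv.precI_of_precI_left
    {r₁ : WeilDeligneRep F C V} {r₂ : WeilDeligneRep F C V'} {s : WeilDeligneRep F C V''}
    (e : r₁.Equiv r₂) (h : r₁.PrecI s) : r₂.PrecI s := by
  obtain ⟨⟨e₀⟩, h⟩ := h
  obtain ⟨e₁⟩ := e.nonempty_restrictInertia_equiv
  exact ⟨⟨e₁.symm.trans e₀⟩, fun d θ hθ hθc k =>
    (e.finrank_map_pow_N_inertiaIsotypic θ k).symm.trans_le (h d θ hθ hθc k)⟩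

/-- `≺_I` is invariant under isomorphism on the left (iff form). [cite: VarmaFMS2024, Definition 8.3] -/
theorem _root_.Literature.NumberTheory.GaloisRepresentations.WeilDeligneRep.Equiv.precI_iff_left
    {r₁ : WeilDeligneRep F C V} {r₂ : WeilDeligneRep F C V'} (e : r₁.Equiv r₂)
    (s : WeilDeligneRep F C V'') : r₁.PrecI s ↔ r₂.PrecI s :=
  ⟨e.precI_of_precI_left, e.symm.precI_of_precI_left⟩

/-- `≺_I` descends to isomorphism classes (right argument). [cite: VarmaFMS2024, Definition 8.3] -/
theorem _root_.Literature.NumberTheory.GaloisRepresentations.WeilDeligneRep.IsEquivalent.precI_iff_right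
    (r : WeilDeligneRep F C V) {s₁ : WeilDeligneRep F C V'} {s₂ : WeilDeligneRep F C V''}
    (h : s₁.IsEquivalent s₂) : r.PrecI s₁ ↔ r.PrecI s₂ :=
  h.some.precI_iff_right r

/-- `≺_I` descends to isomorphism classes (left argument). [cite: VarmaFMS2024, Definition 8.3] -/
theorem _root_.Literature.NumberTheory.GaloisRepresentations.WeilDeligneRep.IsEquivalent.precI_iff_left
    {r₁ : WeilDeligneRep F C V} {r₂ : WeilDeligneRep F C V'} (h : r₁.IsEquivalent r₂)
    (s : WeilDeligneRep F C V'') : r₁.PrecI s ↔ r₂.PrecI s :=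
  h.some.precI_iff_left s

end WeilDeligne

/-! ### The last mile of `theorem12_trace_eq_and_precI` at one place -/

namespace Varma2024

variable {F : Type*} [Field F] [ValuativeRel F] [TopologicalSpace F] [IsNonarchimedeanLocalField F]

/-- Two Frobenius-semisimple representatives of the same class in the target
`Quotient (frobSemisimpleWDSetoid F n)` of `rec_n` have the same traces on `W_F`; so conclusion
(a) of `theorem12_trace_eq_and_precI` does not depend on the representative `S` chosen for
`rec(π_v ⊗ |det|^{(1-n)/2})`. [cite: VarmaFMS2024, Thm. 1] -/
theorem trace_eq_of_mk_eq_mk {n : ℕ}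
    {S S' : {r : WeilDeligneRep F ℂ (Fin n → ℂ) // r.IsFrobSemisimple}}
    (h : Quotient.mk (frobSemisimpleWDSetoid F n) S = Quotient.mk (frobSemisimpleWDSetoid F n) S')
    (w : WeilGroup F) :
    LinearMap.trace ℂ (Fin n → ℂ) (S.1.ρ w) = LinearMap.trace ℂ (Fin n → ℂ) (S'.1.ρ w) := by
  have h' : S.1.IsEquivalent S'.1 := Quotient.exact h
  exact h'.trace_eq w

/-- **The last mile.**  Let `Wℂ`, `S` be complex Weil–Deligne representations of `W_F` on `ℂⁿ`
(in the fact: `Wℂ = ι WD(r|_{Γ_{K_v}})`, `S` a Frobenius-semisimple representative of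
`rec(π_v ⊗ |det|^{(1-n)/2})`).  If some Frobenius-semisimplification `W'` of `Wℂ` has the same
traces as, and is `≺_I`, some `S'` isomorphic to `S` — which is what Varma's Theorem 1
("`WD(r|)^{ss} = ı⁻¹rec(…)^{ss}`", traces being unchanged by semisimplification) and Theorem 2
with Lemma 8.4 (2) ("`WD(r|)^{Frob-ss} ≺_I ı⁻¹rec(…)`") say of the class of `S` — then
`tr Wℂ.ρ(w) = tr S.ρ(w)` for all `w` and `Wℂ ≺_I S`, the conclusion of
`theorem12_trace_eq_and_precI` at the place: traces and `≺_I` pass through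
Frobenius-semisimplification (`IsFrobSemisimplificationOf.trace_eq`, `precI_iff_left`) and
through isomorphism (`Equiv.trace_eq`, `Equiv.precI_of_precI_right`).
[cite: VarmaFMS2024, Thm. 1, Thm. 2 and Lemma 8.4 (2)] -/
theorem traceEq_and_precI_of_frobSemisimplification {n : ℕ}
    {Wℂ W' S S' : WeilDeligneRep F ℂ (Fin n → ℂ)}
    (hW' : W'.IsFrobSemisimplificationOf Wℂ) (hS : S'.IsEquivalent S)
    (htr : ∀ w : WeilGroup F,
      LinearMap.trace ℂ (Fin n → ℂ) (W'.ρ w) = LinearMap.trace ℂ (Fin n → ℂ) (S'.ρ w))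
    (hprec : W'.PrecI S') :
    (∀ w : WeilGroup F,
        LinearMap.trace ℂ (Fin n → ℂ) (Wℂ.ρ w) = LinearMap.trace ℂ (Fin n → ℂ) (S.ρ w)) ∧
      Wℂ.PrecI S := by
  obtain ⟨e⟩ := hS
  refine ⟨fun w => ?_, ?_⟩
  · rw [← hW'.trace_eq w, htr w, e.trace_eq w]
  · exact (hW'.precI_iff_left S).1 (e.precI_of_precI_right hprec)

end Varma2024

end Literature.NumberTheory.Automorphic

end
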